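import Summits.CriticalPhenomena.PercolationContinuityZ3.Theorems.SahiMasterFamilyGHConjecture
import Summits.CriticalPhenomena.PercolationContinuityZ3.Theorems.SahiMasterFamilyPrincipalCapLeSix

/-!
# `(GH)_k` for EVERY `k ≤ 7` and `(UC-hull)_k` for `k ≤ 2` (the small orders)

Unit `prim-masterthm-p4` (gen 15; crux anchor stmt-CriticalPhenomena-4575, helper work; memo
`run/shared/lean/prim/prim-masterthm/prim-masterthm-p4/P4-GEN15-REPORT.md` §8).  Companion of `…GHConjecture` (`GSystemNonneg k` = (GH)_k ⟺ Sahi's `C_k` on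
the principal-cap stratum; `UCHullNonneg k`; `gSystemNonneg_of_le_seven` for `3 ≤ k ≤ 7`, `ucHullNonneg_three`) and `…PrincipalCapLeSix`
(`PrincipalCapBeta.phiSet_one/two`, `phiNonneg_zero/one/two`).  Adds: `phiSet_nonneg_of_box` (`k ≤ 2`: the box `0 ≤ β ≤ 1`, `β_univ = 1` suffices),
**`gSystemNonneg_of_le_seven' : k ≤ 7 → GSystemNonneg k`**, `ucHullNonneg_of_le_two`.  HONEST FRAMING: open for `k ≥ 8` resp. `k ≥ 4`. [this work]
-/

noncomputable section

open scoped Classical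

namespace Summit.CriticalPhenomena.PercolationContinuityZ3.Theorems

namespace GHSmall

open Finset
open Literature.Combinatorics.Sahi2008
open PrincipalCapBeta (phiSet realF realW)

/-- **For `k ≤ 2` the box suffices**: `0 ≤ β ≤ 1` and `β_univ = 1` imply `Φ_k(β) ≥ 0` (`Φ_0 ≥ 0`, `Φ_1 = β_univ`, `Φ_2 = β_univ − β_{0}β_{1}`). [this work] -/
theorem phiSet_nonneg_of_box {k : ℕ} (hk : k ≤ 2) (β : Finset (Fin k) → ℝ) (h0 : ∀ B, 0 ≤ β B) (h1 : ∀ B, β B ≤ 1)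
    (huniv : β univ = 1) : 0 ≤ phiSet k β := by
  interval_cases k
  · -- `PhiNonneg 0` never uses its hypotheses beyond the shape
    exact PrincipalCapBeta.phiNonneg_zero β h0 h1 huniv (fun S T => by
      have : S = ∅ := Finset.eq_empty_of_isEmpty S
      have hT : T = ∅ := Finset.eq_empty_of_isEmpty T
      subst this; subst hT
      rw [Finset.union_empty]
      nlinarith [h0 ∅, h1 ∅])
  · rw [PrincipalCapBeta.phiSet_one, huniv]; exact zero_le_one
  · rw [PrincipalCapBeta.phiSet_two, huniv]
    nlinarith [h0 {0}, h0 {1}, h1 {0}, h1 {1}, mul_le_one₀ (h1 {0}) (h0 {1}) (h1 {1})]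

/-- **`(GH)_k` for every `k ≤ 7`** (orders `≤ 2`: `PrincipalCapBeta.phiNonneg_zero/one/two`; `3..7`: the kernel theorems `F(3),…,F(7)`). [this work] -/
theorem gSystemNonneg_of_le_seven' {k : ℕ} (h7 : k ≤ 7) : GHConjecture.GSystemNonneg k := by
  by_cases h3 : 3 ≤ k
  · exact GHConjecture.gSystemNonneg_of_le_seven h3 h7
  · have hk : k ≤ 2 := by omega
    interval_cases k
    · exact GHConjecture.gSystemNonneg_of_phiNonneg PrincipalCapBeta.phiNonneg_zero
    · exact GHConjecture.gSystemNonneg_of_phiNonneg PrincipalCapBeta.phiNonneg_one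
    · exact GHConjecture.gSystemNonneg_of_phiNonneg PrincipalCapBeta.phiNonneg_two

/-- `(UC-hull)_k` for `k ≤ 2` (mixtures lie in the box with top value one). [this work] -/
theorem ucHullNonneg_of_le_two {k : ℕ} (hk : k ≤ 2) : GHConjecture.UCHullNonneg k := by
  intro α _ w 𝒰 hw0 hw1 _ htop
  set β : Finset (Fin k) → ℝ := fun S => ∑ x, w x * (if S ∈ 𝒰 x then (1 : ℝ) else 0) with hβ
  have h0 : ∀ B, 0 ≤ β B := fun B => sum_nonneg fun x _ => mul_nonneg (hw0 x) (by split_ifs <;> norm_num)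
  have h1 : ∀ B, β B ≤ 1 := fun B => by
    calc β B ≤ ∑ x, w x * 1 := sum_le_sum fun x _ => mul_le_mul_of_nonneg_left (by split_ifs <;> norm_num) (hw0 x)
      _ = 1 := by rw [← sum_mul, hw1, one_mul]
  have huniv : β univ = 1 := by
    have : ∀ x, w x * (if (univ : Finset (Fin k)) ∈ 𝒰 x then (1 : ℝ) else 0) = w x := fun x => by rw [if_pos (htop x), mul_one]
    simp only [hβ, this, hw1]
  exact phiSet_nonneg_of_box hk β h0 h1 huniv

end GHSmall

end Summit.CriticalPhenomena.PercolationContinuityZ3.Theorems
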